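import Literature.AnabelianGeometry.EtaleTheta.Thm56SubdagProofs
import Literature.AnabelianGeometry.EtaleTheta.Thm56SubdagReach
import Literature.AnabelianGeometry.EtaleTheta.Discharge.Sec5TransportLaws
import Literature.AnabelianGeometry.EtaleTheta.Discharge.Sec5UnitsCentralOfBiKummerData
import Literature.AnabelianGeometry.EtaleTheta.Discharge.Sec5Prop55EtaTautological
import Literature.AnabelianGeometry.EtaleTheta.Discharge.Sec5LDeltaCovered

/-!
# [EtTh] Prop. 5.5 at the GENUINE §5 data — assembly of the sub-DAG (PDF pp. 101–102 = printed 327–328)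

Mochizuki, *The étale theta function …*, Publ. RIMS **45** (2009)
[cite: MochizukiEtTh2009, Prop 5.5 p.327 (PDF p.101)].  abc-iut cell, layer L2, row «P55/T56 ASSEMBLY AT THE GENUINE
DATA» (plan/L2/SUBDAG-EtTh-Thm56.md; seat abc-iut-w5-d020 gen 2).  PROOF-ONLY (no definitions).

For the §5 data `𝔉 := ThetaFrobenioid.ofBiKummerData …` ASSEMBLED by abc-iut-L2-t4 from the §3/§4 structures
(W3-L2-01) over a §2 `RigidData` `RD`, this file assembles abc-iut-L2-t4's **`CyclotomicRigidity 𝔉 P hB` = [EtTh]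
Proposition 5.5 (Frobenioid-theoretic Cyclotomic Rigidity: existence AND uniqueness of the functorial
Kummer-determined family `(l·Δ_Θ)_S ⊗ ℤ/Nℤ ⥲ μ_N(S)`)** from the pieces landed along the sub-DAG:
`Thm56Sub.cyclotomicRigidity_of_sub` (p417981: Prop. 5.5 ⟸ named inputs), abc-iut-w5-d123's
`exists_eta_etaTautological_ofBiKummerData` (P55-L02 at the carrier, p418694) and `lDeltaCovered_ofBiKummerData`
(coverage, p419020), this seat's `unitsCentralUnderLDelta_ofBiKummerData` (P55-L02b/T56-L09b, p419587),
`bijectivelyReachableFromBN_of` (P55-L05 «induce isomorphisms», p418311) and the transport laws at the model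
(`ModelFrobenioid.unitsPull_comp/_id`, p418890) — leaving EXACTLY these named inputs, each with its print locator:
* the `ν`-half of the Prop. 5.2 (iii) pin (MERGE-PLAN row 6): `hK` — for the `η` descending the mod-`N` theta cocycle
  `η₀`, the bi-Kummer difference is `ν ∘ η` up to a coboundary (abc-iut-L2-t4's `ThetaPairKummerClass η ν`);
* `hdies` (G-w5d123-1: `B_N` is an `l·N`-codomain — the cocycle dies on `Ker ρ ∩ Π^tp_Ÿ`), the row-2 laws `hlift`/`hpre`/`hP`
  of the subquotient datum `P` and the coefficient identification `e` (G-w5d123-2, abc-iut-L2-t9 MERGE-PLAN row 2);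
* `hgeom` (the part over `(l·Δ_Θ)_{B_N}` is geometric) and `hconst` (geometric automorphisms fix the unit components =
  constants; G-w5d020-1), `hσ` ([FrdI] Prop. 5.6);
* abc-iut-L2-t4's transport step `LinearlyReachableFromBN` at the data ([FrdI] Def. 1.3 (i)(b)) — NB (abc-iut-L2-lead ruling
  F-w5d123-3, 03:32Z, quantifier level): this typed predicate FIXES the source `B_N` and is STRONGER THAN PRINT (p.328
  transports from VARYING `l·N`-codomains `S″`); at the carrier it is a binder that deep theta-saturated `S` may not meet —
  the print-faithful variant over abc-iut-w5-d123's `ReachableFromCodomains` (row #3) is the announced sequel — and the independence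
  `TransportIndependent ν` (P55-L06 — abc-iut-w4-d008's `transportIndependent_of` reduces it further at the abstract
  data), and the two functoriality laws of the FREE subquotient stub `Q` (`LDeltaMapComp/Id`; automatic for
  abc-iut-L2-t9's `thetaSubquotientStub` by `thetaSubquotientStub_lDeltaMap_comp/_id`, p418890).
HONEST FRAMING: a kernel-checked implication between typed statements about the assembled §5 data; nothing of [EtTh] is
asserted unconditionally; nothing asserts that such data exist for an actual curve; typed ≠ discharged; no side taken on
[IUTchIII] Cor. 3.12.
-/

noncomputable section

namespace Literature.AnabelianGeometry.EtaleTheta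

open CategoryTheory Opposite FrobenioidCyclotomicRigidity Literature.AlgebraicGeometry.Frobenioids

universe u₀ v₀ u v w

namespace ThetaFrobenioid

variable {K : Type u₀} [Field K]
  {X : SemiGraphs.TemperedArithmeticGroup.{u₀} K} {D₀ : Type u₀} [Category.{v₀} D₀]
  {V : FrdIMonoidStub.{w}} {T₀ : RealifiedDivisorMonoids (D₀ := D₀) V} {D : Type u} [Category.{v} D]
  {VD : FrdICatStub.{u, v, w} D} {S : BiKummerSetting X T₀ D VD}
  {pullFrac : ∀ {A A' : S.C} (_ : A' ⟶ A), S.biratUnits A → S.biratUnits A'}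
  {lv N : ℕ+} {l' : ℕ} {RD : RigidData.{max v w} N l'} {θ : S.biratUnits S.Aodot} {Bl : S.C}
  {Pl : S.FractionPair θ Bl} {Rl : S.NthRoot θ Pl lv pullFrac}
  (h : ModelFrobenioid.Hypotheses S.tf.divisorMonoid S.tf.ratFnFunctor)
  (toB : ∀ A : S.C, S.biratUnits A →* S.tf.biratUnitsModel A) (Q : FrobenioidTheta.ThetaSubquotientStub.{w} D)
  (odd_l : Odd (lv : ℕ)) (R : S.NthRoot Rl.root Rl.pair N pullFrac) (ιX : RD.PiX ≃ₜ* X.Pi)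
  (hopen : IsOpen ((S.galoisSurj R.AN.base R.αData.isGalois).ker : Set X.Pi)) (σ : Aut R.AN.base →* Aut R.AN)
  (K' : Type w) [Field K'] (constEmb : K'ˣ →* S.tf.biratUnitsModel R.BN)
  (constEmb_injective : Function.Injective constEmb)
  (hdivc : ∀ g : Aut R.BN.base,
    ModelFrobenioid.div ((σ ((BiKummerSetting.NthRoot.baseIso S R).conjAut.symm g)).hom ≫ R.pair.num) =
      ModelFrobenioid.div R.pair.num)
  (hdivp : ∀ y : RD.PiYdd,
    ModelFrobenioid.div ((σ (S.galoisSurj R.AN.base R.αData.isGalois (ιX y.1))).hom ≫ R.pair.den) =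
      ModelFrobenioid.div R.pair.den)

/-- The stub's unit pull-back of the assembled data IS the model Frobenioid's `unitsPull` — so it is compositional
(`Thm56Sub.UnitsPullComp`, by `ModelFrobenioid.unitsPull_comp`).  [cite: MochizukiEtTh2009, Prop 5.5 proof p.328 (PDF p.102)] -/
theorem unitsPullComp_ofBiKummerData :
    Thm56Sub.UnitsPullComp (ofBiKummerData h toB Q odd_l R ιX hopen σ K' constEmb constEmb_injective hdivc hdivp) :=
  fun φ ψ => ModelFrobenioid.unitsPull_comp φ ψ

/-- `Thm56Sub.UnitsPullId` for the assembled data (by `ModelFrobenioid.unitsPull_id`).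
[cite: MochizukiEtTh2009, Prop 5.5 proof p.328 (PDF p.102)] -/
theorem unitsPullId_ofBiKummerData :
    Thm56Sub.UnitsPullId (ofBiKummerData h toB Q odd_l R ιX hopen σ K' constEmb constEmb_injective hdivc hdivp) :=
  fun S' => ModelFrobenioid.unitsPull_id S'

/-- `Thm56Sub.UnitsPullSpec` for the assembled data (abc-iut-L2-t9's `comp_eq_unitsPull_comp`, re-oriented).
[cite: MochizukiEtTh2009, §4 p.312 (PDF p.86)] -/
theorem unitsPullSpec_ofBiKummerData :
    Thm56Sub.UnitsPullSpec (ofBiKummerData h toB Q odd_l R ιX hopen σ K' constEmb constEmb_injective hdivc hdivp) :=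
  fun φ hφ τ => (ModelFrobenioid.comp_eq_unitsPull_comp φ hφ τ).symm

/-- **[EtTh] Proposition 5.5 (Frobenioid-theoretic Cyclotomic Rigidity) for the ASSEMBLED §5 data** — abc-iut-L2-t4's
`CyclotomicRigidity (ofBiKummerData …) P hB` (existence ∧ uniqueness of a rigidity family that is Kummer-determined on
`B_N` and functorial for linear morphisms of `(l, N)`-theta-saturated objects), from the sub-DAG pieces (module
docstring), MODULO the named inputs `hK` (ν-half of the Prop. 5.2 (iii) pin), `hdies`, `e`/`he`, `hlift`/`hpre`/`hP`
(row-2 laws), `hσ`, `hgeom`, `hconst`, `hreach` (t4's transport step at the data), `hind` (P55-L06), `hLc`/`hLi` (laws of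
the free subquotient stub `Q`).  [cite: MochizukiEtTh2009, Prop 5.5 p.327–328 (PDF pp.101–102)] -/
theorem cyclotomicRigidity_ofBiKummerData
    (hB : (ofBiKummerData h toB Q odd_l R ιX hopen σ K' constEmb constEmb_injective hdivc hdivp).IsThetaSaturated
      (ofBiKummerData h toB Q odd_l R ιX hopen σ K' constEmb constEmb_injective hdivc hdivp).BN)
    (P : ThetaSubquotientProj (ofBiKummerData h toB Q odd_l R ιX hopen σ K' constEmb constEmb_injective hdivc hdivp))
    -- the η-side (abc-iut-w5-d123, P55-L02 at the carrier) and coverage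
    {η₀ : RD.PiYdd → RD.mu} (hη₀ : η₀ ∈ RD.thetaCocycles)
    (hdies : ∀ k : RD.PiYdd, rhoOfBiKummerData R ιX k = 1 → η₀ k = 1)
    (e : RD.mu → (ofBiKummerData h toB Q odd_l R ιX hopen σ K' constEmb constEmb_injective hdivc hdivp).lDeltaModN
      (ofBiKummerData h toB Q odd_l R ιX hopen σ K' constEmb constEmb_injective hdivc hdivp).BN)
    (he : Function.Surjective e)
    (hlift : ∀ a ∈ (ofBiKummerData h toB Q odd_l R ιX hopen σ K' constEmb constEmb_injective hdivc hdivp).HB,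
      a ∈ P.pre _ → ∃ k : RD.PiYdd, (k : RD.PiX) ∈ RD.lDeltaTheta ∧ rhoOfBiKummerData R ιX k = a)
    (hpre : ∀ k : RD.PiYdd, (k : RD.PiX) ∈ RD.lDeltaTheta → rhoOfBiKummerData R ιX k ∈ P.pre _)
    (hP : ∀ (k : RD.PiYdd) (hk : (k : RD.PiX) ∈ RD.lDeltaTheta) (hm : rhoOfBiKummerData R ιX k ∈ P.pre _),
      (QuotientGroup.mk (P.proj _ ⟨rhoOfBiKummerData R ιX k, hm⟩) :
          (ofBiKummerData h toB Q odd_l R ιX hopen σ K' constEmb constEmb_injective hdivc hdivp).lDeltaModN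
            (ofBiKummerData h toB Q odd_l R ιX hopen σ K' constEmb constEmb_injective hdivc hdivp).BN) =
        e (RD.thetaMod ⟨k, hk⟩))
    -- the ν-half of the Prop. 5.2 (iii) pin, for the descended η
    (ν : (ofBiKummerData h toB Q odd_l R ιX hopen σ K' constEmb constEmb_injective hdivc hdivp).lDeltaModN
        (ofBiKummerData h toB Q odd_l R ιX hopen σ K' constEmb constEmb_injective hdivc hdivp).BN ≃*
      (ofBiKummerData h toB Q odd_l R ιX hopen σ K' constEmb constEmb_injective hdivc hdivp).muTorsion
        (ofBiKummerData h toB Q odd_l R ιX hopen σ K' constEmb constEmb_injective hdivc hdivp).BN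
        (ofBiKummerData h toB Q odd_l R ιX hopen σ K' constEmb constEmb_injective hdivc hdivp).N)
    (hK : ∀ η : (ofBiKummerData h toB Q odd_l R ιX hopen σ K' constEmb constEmb_injective hdivc hdivp).HB →
        (ofBiKummerData h toB Q odd_l R ιX hopen σ K' constEmb constEmb_injective hdivc hdivp).lDeltaModN
          (ofBiKummerData h toB Q odd_l R ιX hopen σ K' constEmb constEmb_injective hdivc hdivp).BN,
      (∀ k : RD.PiYdd, η ⟨rhoOfBiKummerData R ιX k, Subgroup.mem_map_of_mem _ k.2⟩ = e (η₀ k)) →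
        FrobenioidThetaBiKummer.ThetaPairKummerClass
          (ofBiKummerData h toB Q odd_l R ιX hopen σ K' constEmb constEmb_injective hdivc hdivp) η ν)
    -- centrality of the geometric part (this seat, T56-L09b at the data)
    (hσ : ∀ g : Aut R.AN.base, ModelFrobenioid.baseMap (σ g).hom = g.hom)
    (hgeom : P.pre R.BN.base ≤ RD.aug.ker.map (rhoOfBiKummerData R ιX))
    (hconst : ∀ δ ∈ RD.aug.ker, ∀ τ : ModelFrobenioid.units R.BN,
      (S.tf.ratFnFunctor.map (rhoOfBiKummerData R ιX δ).hom.op).hom (ModelFrobenioid.unit τ.1.hom) =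
        ModelFrobenioid.unit τ.1.hom)
    -- the transport step and its independence, the laws of the free subquotient stub
    (hreach : LinearlyReachableFromBN
      (ofBiKummerData h toB Q odd_l R ιX hopen σ K' constEmb constEmb_injective hdivc hdivp))
    (hind : Thm56Sub.TransportIndependent
      (ofBiKummerData h toB Q odd_l R ιX hopen σ K' constEmb constEmb_injective hdivc hdivp) ν)
    (hLc : Thm56Sub.LDeltaMapComp
      (ofBiKummerData h toB Q odd_l R ιX hopen σ K' constEmb constEmb_injective hdivc hdivp))
    (hLi : Thm56Sub.LDeltaMapId
      (ofBiKummerData h toB Q odd_l R ιX hopen σ K' constEmb constEmb_injective hdivc hdivp)) :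
    CyclotomicRigidity (ofBiKummerData h toB Q odd_l R ιX hopen σ K' constEmb constEmb_injective hdivc hdivp) P hB := by
  -- the descended, tautological η (abc-iut-w5-d123)
  obtain ⟨η, hηdesc, hηtaut⟩ := exists_eta_etaTautological_ofBiKummerData h toB Q odd_l R ιX hopen σ K' constEmb
    constEmb_injective hdivc hdivp hη₀ hdies e P hlift hP
  exact Thm56Sub.cyclotomicRigidity_of_sub P hB (hK η hηdesc) hηtaut
    (unitsCentralUnderLDelta_ofBiKummerData h toB Q odd_l R ιX hopen σ K' constEmb constEmb_injective hdivc hdivp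
      hσ P hgeom hconst)
    (Thm56Sub.bijectivelyReachableFromBN_of _ hB hreach) hind
    (unitsPullComp_ofBiKummerData h toB Q odd_l R ιX hopen σ K' constEmb constEmb_injective hdivc hdivp)
    (unitsPullId_ofBiKummerData h toB Q odd_l R ιX hopen σ K' constEmb constEmb_injective hdivc hdivp) hLc hLi
    (lDeltaCovered_ofBiKummerData h toB Q odd_l R ιX hopen σ K' constEmb constEmb_injective hdivc hdivp e he P hpre hP)

end ThetaFrobenioid

end Literature.AnabelianGeometry.EtaleTheta
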